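import Summits.QuantumFields.YangMills.Theorems.UnitScaleTiltProp8FlatPlaqDeriv
import HarnessLib

/-!
# Route `UnitScaleTilt`, crux K1 child «MinimiserStabilityRegPr» (stmt-QuantumFields-19200), leaf V2′ `stub_halvingStep` — pillar P3b
# ([Balaban1985Variational] PROP. 4 AT BACKGROUND 1), PART 3b: **THE PAIRED SLOT DERIVATIVES OF THE PER-PLAQUETTE FUNCTION `𝔣`** — the two plaquettes
# of a lattice plane through a bond, differentiated in the bond's slot (1 and 3, resp. 4 and 2), sum to `O(‖H‖·(mΔ + mδ + δ²)) + O(m′⁴/ρ)`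
# (matrix analysis only; the lattice enters in PART 4 through the meaning of `Δ`, `δ`)

Cell `ym3-torus` (HUMAN RULING D-0037, YM ladder rung R3), width seat `ym-ust-19200-w5` gen 0 (OWNER ym3-torus-plan g24, W-SEAT MAP pass #2: «w5 = P3b»).
`--supports stmt-QuantumFields-19200 --as helper`; count-neutral.  YM₃ on T³ is a ladder rung (R3), not the Clay problem; nothing here is a claim about the
crux, d = 4 or the mass gap.

WHAT IS PROVED (sorry-free, no definition; `𝔣(Y) = 1 − ½tr(e^{Y₁}e^{Y₂}e^{Y₃}e^{Y₄}) + ½tr(ΣYᵢ) + ¼tr((ΣYᵢ)²)` as in PART 3, `∇₁C` as in PART 1b):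
* `differentiable_frak_line4` — `t ↦ 𝔣(Y₁ + tK₁, …, Y₄ + tK₄)` is differentiable (all four slots moving; used for the sum rule over plaquettes).
* **`norm_deriv_pair13_le`** — slots `Y` of `p_{μν}(x)` (bond in slot 1, direction `H`) and `Z` of `p_{μν}(x − e_ν)` (bond in slot 3, direction `−H`):
  for `‖Yᵢ‖, ‖Zᵢ‖ ≤ m`, slotwise `‖Yᵢ − Zᵢ‖ ≤ Δ`, `‖Y₁ + Y₃‖, ‖Y₂ + Y₄‖ ≤ δ`, `0 < ρ`, `m + ρ‖H‖ ≤ 1`: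
  `‖d/dt 𝔣(Y₁ + tH, Y₂, Y₃, Y₄)|₀ + d/dt 𝔣(Z₁, Z₂, Z₃ + t(−H), Z₄)|₀‖ ≤ ‖H‖(16mΔ + 4mδ + δ²) + 88(m + ρ‖H‖)⁴/ρ`
  (PART 3 `norm_deriv_frak_slot1_add_le` at `Y` and — through `frak_rotate` — at the half-turn `(Z₃, Z₄, Z₁, Z₂)`, then PART 1b
  `norm_grad1_sub_grad1_halfturn_le`: the two exact cubic gradients cancel up to the differences).
* **`norm_deriv_pair42_le`** — the same for the bond in slot 4 of `p_{νμ}(x)` (direction `−H`) and slot 2 of `p_{νμ}(x − e_ν)` (direction `H`), with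
  `‖Z₂ + Z₄‖, ‖Z₃ + Z₁‖ ≤ δ`.
This is print's (93)–(96) («we can use the factor η to replace this derivative by a simple difference operation … O(1)|∇A′||A′|») at background 1, per plane.
HONEST SCOPE.  Elementary ([folklore]); nothing of Bałaban's is asserted.  Axioms standard.

References: T. Bałaban, CMP **102** (1985) 277–309 [Balaban1985Variational] (90)–(98) pp.291–293.
-/

set_option autoImplicit false

noncomputable section

open scoped BigOperators Matrix.Norms.L2Operator
open NormedSpace

namespace Summit.QuantumFields.YangMills.Theorems.FlatPlaqDeriv

open Literature.MathematicalPhysics.QuantumFieldTheory.Balaban1983to89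
open Summit.QuantumFields.YangMills.Theorems.FlatPlaqCubic

/-- `t ↦ 𝔣(Y₁ + tK₁, Y₂ + tK₂, Y₃ + tK₃, Y₄ + tK₄)` is differentiable (every slot moving affinely). [cite: Balaban1985Variational, p.282 («an entire function of A»)] -/
theorem differentiable_frak_line4 (Y₁ Y₂ Y₃ Y₄ K₁ K₂ K₃ K₄ : Matrix (Fin 2) (Fin 2) ℂ) :
    Differentiable ℂ (fun t : ℂ => (1 - (2 : ℂ)⁻¹ * Matrix.trace (exp (Y₁ + t • K₁) * exp (Y₂ + t • K₂) * exp (Y₃ + t • K₃) * exp (Y₄ + t • K₄)) + (2 : ℂ)⁻¹ * Matrix.trace ((Y₁ + t • K₁) + (Y₂ + t • K₂) + (Y₃ + t • K₃) + (Y₄ + t • K₄)) + (4 : ℂ)⁻¹ * Matrix.trace (((Y₁ + t • K₁) + (Y₂ + t • K₂) + (Y₃ + t • K₃) + (Y₄ + t • K₄)) ^ 2))) := by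
  have hT : Differentiable ℂ (fun X : Matrix (Fin 2) (Fin 2) ℂ => Matrix.trace X) :=
    (LinearMap.toContinuousLinearMap (Matrix.traceLinearMap (Fin 2) ℂ ℂ)).differentiable
  have hE := (((differentiable_exp_line Y₁ K₁).mul (differentiable_exp_line Y₂ K₂)).mul (differentiable_exp_line Y₃ K₃)).mul
    (differentiable_exp_line Y₄ K₄)
  have hS : Differentiable ℂ (fun t : ℂ => Y₁ + t • K₁ + (Y₂ + t • K₂) + (Y₃ + t • K₃) + (Y₄ + t • K₄)) :=
    (((differentiable_line Y₁ K₁).add (differentiable_line Y₂ K₂)).add (differentiable_line Y₃ K₃)).add (differentiable_line Y₄ K₄)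
  exact (((differentiable_const _).sub ((hT.comp hE).const_mul _)).add ((hT.comp hS).const_mul _)).add ((hT.comp (hS.pow 2)).const_mul _)

/-- The bookkeeping of a pair: `‖d₁ + d₂‖ ≤ ‖d₁ + a‖ + ‖d₂ − a′‖ + ‖a − a′‖`-type step with the traces combined. [folklore] -/
theorem norm_pair_le (d₁ d₂ : ℂ) (H GY GZ : Matrix (Fin 2) (Fin 2) ℂ) {B e : ℝ}
    (h1 : ‖d₁ + (2 : ℂ)⁻¹ * Matrix.trace (H * GY)‖ ≤ e) (h2 : ‖d₂ + (2 : ℂ)⁻¹ * Matrix.trace (-H * GZ)‖ ≤ e) (hG : ‖GY - GZ‖ ≤ B) :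
    ‖d₁ + d₂‖ ≤ ‖H‖ * B + 2 * e := by
  have key : d₁ + d₂ = (d₁ + (2 : ℂ)⁻¹ * Matrix.trace (H * GY)) + (d₂ + (2 : ℂ)⁻¹ * Matrix.trace (-H * GZ))
      - (2 : ℂ)⁻¹ * Matrix.trace (H * (GY - GZ)) := by
    rw [mul_sub, Matrix.trace_sub, neg_mul, Matrix.trace_neg]; ring
  rw [key]
  have htr : ‖(2 : ℂ)⁻¹ * Matrix.trace (H * (GY - GZ))‖ ≤ ‖H‖ * B := by
    rw [norm_mul, norm_inv, Complex.norm_ofNat]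
    have := norm_trace_mul_le H (GY - GZ)
    nlinarith [norm_nonneg H, mul_le_mul_of_nonneg_left hG (norm_nonneg H)]
  calc _ ≤ ‖(d₁ + (2 : ℂ)⁻¹ * Matrix.trace (H * GY)) + (d₂ + (2 : ℂ)⁻¹ * Matrix.trace (-H * GZ))‖
        + ‖(2 : ℂ)⁻¹ * Matrix.trace (H * (GY - GZ))‖ := norm_sub_le _ _
    _ ≤ (e + e) + ‖H‖ * B := add_le_add ((norm_add_le _ _).trans (add_le_add h1 h2)) htr
    _ = ‖H‖ * B + 2 * e := by ring

/-- **THE (1,3)-PAIR**: bond in slot 1 of `Y` (direction `H`) and slot 3 of `Z` (direction `−H`). [cite: Balaban1985Variational, (93)-(96) p.292] -/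
theorem norm_deriv_pair13_le (Y₁ Y₂ Y₃ Y₄ Z₁ Z₂ Z₃ Z₄ H : Matrix (Fin 2) (Fin 2) ℂ) {m Δ δ ρ : ℝ} (hm : 0 ≤ m)
    (h1 : ‖Y₁‖ ≤ m) (h2 : ‖Y₂‖ ≤ m) (h3 : ‖Y₃‖ ≤ m) (h4 : ‖Y₄‖ ≤ m)
    (g1 : ‖Z₁‖ ≤ m) (g2 : ‖Z₂‖ ≤ m) (g3 : ‖Z₃‖ ≤ m) (g4 : ‖Z₄‖ ≤ m)
    (d1 : ‖Y₁ - Z₁‖ ≤ Δ) (d2 : ‖Y₂ - Z₂‖ ≤ Δ) (d3 : ‖Y₃ - Z₃‖ ≤ Δ) (d4 : ‖Y₄ - Z₄‖ ≤ Δ)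
    (hS : ‖Y₁ + Y₃‖ ≤ δ) (hT : ‖Y₂ + Y₄‖ ≤ δ) (hρ : 0 < ρ) (hm1 : m + ρ * ‖H‖ ≤ 1) :
    ‖deriv (fun t : ℂ => (1 - (2 : ℂ)⁻¹ * Matrix.trace (exp (Y₁ + t • H) * exp Y₂ * exp Y₃ * exp Y₄) + (2 : ℂ)⁻¹ * Matrix.trace ((Y₁ + t • H) + Y₂ + Y₃ + Y₄) + (4 : ℂ)⁻¹ * Matrix.trace (((Y₁ + t • H) + Y₂ + Y₃ + Y₄) ^ 2))) 0
      + deriv (fun t : ℂ => (1 - (2 : ℂ)⁻¹ * Matrix.trace (exp Z₁ * exp Z₂ * exp (Z₃ + t • (-H)) * exp Z₄) + (2 : ℂ)⁻¹ * Matrix.trace (Z₁ + Z₂ + (Z₃ + t • (-H)) + Z₄) + (4 : ℂ)⁻¹ * Matrix.trace ((Z₁ + Z₂ + (Z₃ + t • (-H)) + Z₄) ^ 2))) 0‖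
      ≤ ‖H‖ * (16 * m * Δ + 4 * m * δ + δ ^ 2) + 2 * (44 * (m + ρ * ‖H‖) ^ 4 / ρ) := by
  -- slot 3 of `Z` is slot 1 of the half-turn `(Z₃, Z₄, Z₁, Z₂)`
  have hrot : (fun t : ℂ => (1 - (2 : ℂ)⁻¹ * Matrix.trace (exp Z₁ * exp Z₂ * exp (Z₃ + t • (-H)) * exp Z₄) + (2 : ℂ)⁻¹ * Matrix.trace (Z₁ + Z₂ + (Z₃ + t • (-H)) + Z₄) + (4 : ℂ)⁻¹ * Matrix.trace ((Z₁ + Z₂ + (Z₃ + t • (-H)) + Z₄) ^ 2))) =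
      fun t : ℂ => (1 - (2 : ℂ)⁻¹ * Matrix.trace (exp (Z₃ + t • (-H)) * exp Z₄ * exp Z₁ * exp Z₂) + (2 : ℂ)⁻¹ * Matrix.trace ((Z₃ + t • (-H)) + Z₄ + Z₁ + Z₂) + (4 : ℂ)⁻¹ * Matrix.trace (((Z₃ + t • (-H)) + Z₄ + Z₁ + Z₂) ^ 2)) := by
    funext t
    exact (frak_rotate Z₄ Z₁ Z₂ (Z₃ + t • (-H))).trans (frak_rotate (Z₃ + t • (-H)) Z₄ Z₁ Z₂)
  rw [hrot]
  have e1 := norm_deriv_frak_slot1_add_le Y₁ Y₂ Y₃ Y₄ H h1 h2 h3 h4 hρ hm1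
  have e2 := norm_deriv_frak_slot1_add_le Z₃ Z₄ Z₁ Z₂ (-H) g3 g4 g1 g2 hρ (by rwa [norm_neg])
  rw [norm_neg] at e2
  have hG := norm_grad1_sub_grad1_halfturn_le hm h1 h2 h3 h4 g1 g2 g3 g4 d1 d2 d3 d4 hS hT
  exact norm_pair_le _ _ H _ _ e1 e2 hG
set_option maxHeartbeats 400000 in
/-- **THE (4,2)-PAIR**: bond in slot 4 of `Y` (direction `−H`) and slot 2 of `Z` (direction `H`); small sums `Z₂ + Z₄`, `Z₃ + Z₁`.
[cite: Balaban1985Variational, (93)-(96) p.292] -/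
theorem norm_deriv_pair42_le (Y₁ Y₂ Y₃ Y₄ Z₁ Z₂ Z₃ Z₄ H : Matrix (Fin 2) (Fin 2) ℂ) {m Δ δ ρ : ℝ} (hm : 0 ≤ m)
    (h1 : ‖Y₁‖ ≤ m) (h2 : ‖Y₂‖ ≤ m) (h3 : ‖Y₃‖ ≤ m) (h4 : ‖Y₄‖ ≤ m)
    (g1 : ‖Z₁‖ ≤ m) (g2 : ‖Z₂‖ ≤ m) (g3 : ‖Z₃‖ ≤ m) (g4 : ‖Z₄‖ ≤ m)
    (d1 : ‖Y₁ - Z₁‖ ≤ Δ) (d2 : ‖Y₂ - Z₂‖ ≤ Δ) (d3 : ‖Y₃ - Z₃‖ ≤ Δ) (d4 : ‖Y₄ - Z₄‖ ≤ Δ)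
    (hS : ‖Z₂ + Z₄‖ ≤ δ) (hT : ‖Z₃ + Z₁‖ ≤ δ) (hρ : 0 < ρ) (hm1 : m + ρ * ‖H‖ ≤ 1) :
    ‖deriv (fun t : ℂ => (1 - (2 : ℂ)⁻¹ * Matrix.trace (exp Z₁ * exp (Z₂ + t • H) * exp Z₃ * exp Z₄) + (2 : ℂ)⁻¹ * Matrix.trace (Z₁ + (Z₂ + t • H) + Z₃ + Z₄) + (4 : ℂ)⁻¹ * Matrix.trace ((Z₁ + (Z₂ + t • H) + Z₃ + Z₄) ^ 2))) 0
      + deriv (fun t : ℂ => (1 - (2 : ℂ)⁻¹ * Matrix.trace (exp Y₁ * exp Y₂ * exp Y₃ * exp (Y₄ + t • (-H))) + (2 : ℂ)⁻¹ * Matrix.trace (Y₁ + Y₂ + Y₃ + (Y₄ + t • (-H))) + (4 : ℂ)⁻¹ * Matrix.trace ((Y₁ + Y₂ + Y₃ + (Y₄ + t • (-H))) ^ 2))) 0‖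
      ≤ ‖H‖ * (16 * m * Δ + 4 * m * δ + δ ^ 2) + 2 * (44 * (m + ρ * ‖H‖) ^ 4 / ρ) := by
  -- slot 2 of `Z` is slot 1 of `(Z₂, Z₃, Z₄, Z₁)`; slot 4 of `Y` is slot 1 of `(Y₄, Y₁, Y₂, Y₃)`
  have hrotZ : (fun t : ℂ => (1 - (2 : ℂ)⁻¹ * Matrix.trace (exp Z₁ * exp (Z₂ + t • H) * exp Z₃ * exp Z₄) + (2 : ℂ)⁻¹ * Matrix.trace (Z₁ + (Z₂ + t • H) + Z₃ + Z₄) + (4 : ℂ)⁻¹ * Matrix.trace ((Z₁ + (Z₂ + t • H) + Z₃ + Z₄) ^ 2))) =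
      fun t : ℂ => (1 - (2 : ℂ)⁻¹ * Matrix.trace (exp (Z₂ + t • H) * exp Z₃ * exp Z₄ * exp Z₁) + (2 : ℂ)⁻¹ * Matrix.trace ((Z₂ + t • H) + Z₃ + Z₄ + Z₁) + (4 : ℂ)⁻¹ * Matrix.trace (((Z₂ + t • H) + Z₃ + Z₄ + Z₁) ^ 2)) := by
    funext t
    exact (frak_rotate Z₁ (Z₂ + t • H) Z₃ Z₄).symm
  have hrotY : (fun t : ℂ => (1 - (2 : ℂ)⁻¹ * Matrix.trace (exp Y₁ * exp Y₂ * exp Y₃ * exp (Y₄ + t • (-H))) + (2 : ℂ)⁻¹ * Matrix.trace (Y₁ + Y₂ + Y₃ + (Y₄ + t • (-H))) + (4 : ℂ)⁻¹ * Matrix.trace ((Y₁ + Y₂ + Y₃ + (Y₄ + t • (-H))) ^ 2))) =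
      fun t : ℂ => (1 - (2 : ℂ)⁻¹ * Matrix.trace (exp (Y₄ + t • (-H)) * exp Y₁ * exp Y₂ * exp Y₃) + (2 : ℂ)⁻¹ * Matrix.trace ((Y₄ + t • (-H)) + Y₁ + Y₂ + Y₃) + (4 : ℂ)⁻¹ * Matrix.trace (((Y₄ + t • (-H)) + Y₁ + Y₂ + Y₃) ^ 2)) := by
    funext t
    exact frak_rotate (Y₄ + t • (-H)) Y₁ Y₂ Y₃
  rw [hrotZ, hrotY]
  have e1 := norm_deriv_frak_slot1_add_le Z₂ Z₃ Z₄ Z₁ H g2 g3 g4 g1 hρ hm1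
  have e2 := norm_deriv_frak_slot1_add_le Y₄ Y₁ Y₂ Y₃ (-H) h4 h1 h2 h3 hρ (by rwa [norm_neg])
  rw [norm_neg] at e2
  have d1' : ‖Z₁ - Y₁‖ ≤ Δ := by rwa [norm_sub_rev]
  have d2' : ‖Z₂ - Y₂‖ ≤ Δ := by rwa [norm_sub_rev]
  have d3' : ‖Z₃ - Y₃‖ ≤ Δ := by rwa [norm_sub_rev]
  have d4' : ‖Z₄ - Y₄‖ ≤ Δ := by rwa [norm_sub_rev]
  have hG := norm_grad1_sub_grad1_halfturn_le (Y₁ := Z₂) (Y₂ := Z₃) (Y₃ := Z₄) (Y₄ := Z₁) (Z₁ := Y₂) (Z₂ := Y₃) (Z₃ := Y₄) (Z₄ := Y₁)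
    hm g2 g3 g4 g1 h2 h3 h4 h1 d2' d3' d4' d1' hS hT
  exact norm_pair_le _ _ H _ _ e1 e2 hG

end Summit.QuantumFields.YangMills.Theorems.FlatPlaqDeriv

end
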